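import Summits.CriticalPhenomena.Ising3DConformalLimit.Theorems.ArmHyperscalingOneArmHyperscalingMirrorFaceDefs
import Summits.CriticalPhenomena.Ising3DConformalLimit.Theorems.ArmHyperscalingOneArmHyperscalingStubMirrorCauchySchwarz
import Summits.CriticalPhenomena.Ising3DConformalLimit.Theorems.ArmHyperscalingOneArmHyperscalingStubPlusMagSubmodular
import Summits.CriticalPhenomena.Ising3DConformalLimit.Theorems.ArmHyperscalingOneArmHyperscalingStubBoxMagMarkov
import Summits.CriticalPhenomena.Ising3DConformalLimit.Theorems.ArmHyperscalingOneArmHyperscalingStubFaceGeometry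
import Summits.CriticalPhenomena.Ising3DConformalLimit.Theorems.ArmHyperscalingOneArmHyperscalingStubFaceSymmetry
import Summits.CriticalPhenomena.Ising3DConformalLimit.Theorems.ArmHyperscalingOneArmHyperscalingStubFaceLimit
import Literature.Probability.LatticeModels.HighDimPointwiseTriviality
import HarnessLib

/-!
# Crux `ArmHyperscaling.OneArmHyperscaling` (stmt-CriticalPhenomena-15591) REDUCED to the face-saturation inequality
(line `mirror-face-saturation`; lead prover-line-stmt-CriticalPhenomena-15591-0, 2026-08-17)

Sorry-free glue of the registered skeleton `Cruxes/OneArmHyperscaling/Lines/mirror_face_saturation.lean`, over the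
LANDED definitions module `…MirrorFaceDefs` (p158919) and the six LANDED stubs `stub_mirrorCauchySchwarz` (p160282),
`stub_plusMagSubmodular` (p160632), `stub_boxMagMarkov` (p161308), `stub_faceGeometry` (p161080), `stub_faceSymmetry`
(p161255), `stub_faceLimit` (p161287):

* `faceSubadditivity_proof : FaceSubadditivity` — `0 ≤ m⁺_{Kn} ≤ 6 · faceMag K n` (registered glue sub-goal; the
  strategist's original stub `stub_faceSubadditivity`, now a theorem): for `L ≥ Kn + n + 1`,
  `m⁺_{Kn} = ⟨σ_x⟩⁺_{Λ_L ∖ ⋃ faces}` (MKV) `≤ Σ_i ⟨σ_x⟩⁺_{Λ_L ∖ face_i} − 5⟨σ_x⟩⁺_{Λ_L}` (SUB with GEO)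
  `≤ Σ_i ⟨σ_x⟩⁺_{(Λ_L + v_i) ∖ facePatch}` (GKS I, SYM) `→ 6 · faceMag K n` (LIM);
* `OneArmHyperscaling_of : MirrorCauchySchwarz → FaceSubadditivity → FaceSaturation → OneArmHyperscaling` — the
  strategist's real-arithmetic composition `m⁺² ≤ 36F² ≤ 36C²T²/S ≤ 36C²⟨σ₀σ_{2ne₀}⟩`;
* `OneArmHyperscaling_of_faceSaturation : FaceSaturation → OneArmHyperscaling` (registered glue sub-goal) — the
  crux BY NAME from its one open core, the face-saturation inequality
  `∃ K ≥ 2, ∃ C, ∀ n ≥ 1, faceMag K n ≤ C · faceResponse K n / √(mirrorGram K n)` (expected true on `ℤ³` by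
  scaling — both sides `≍ (Kn)^{-Δσ}` — and false for `d > 4` exactly like the crux; no proof is claimed here).

Nothing in this file is conditional on an unproved fact except through the explicit hypothesis `FaceSaturation`.
-/

noncomputable section

namespace Summit.CriticalPhenomena.Ising3DConformalLimit.Cruxes.OneArmHyperscaling.MirrorFaceSaturation

open Literature.Probability.LatticeModels Finset

/-! ### Glue: the five face stubs give `FaceSubadditivity` -/

/-- `FaceSubadditivity` from (SUB), (MKV), (GEO), (SYM), (LIM): for `L ≥ Kn + n + 1`,
`m⁺_{Kn} = ⟨σ_x⟩⁺_{Λ_L∖⋃faces} ≤ Σ_i ⟨σ_x⟩⁺_{Λ_L∖face_i} − 5⟨σ_x⟩⁺_{Λ_L} ≤ Σ_i ⟨σ_x⟩⁺_{(Λ_L+v_i)∖facePatch} → 6 F`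
(GKS I for the dropped term), and `m⁺ ≥ 0` by GKS I. -/
theorem faceSubadditivity_of (hSUB : PlusMagSubmodular) (hMKV : BoxMagMarkov) (hGEO : FaceGeometry)
    (hSYM : FaceSymmetry) (hLIM : FaceLimit) : FaceSubadditivity := by
  intro K n hK hn
  have hβ : (0 : ℝ) ≤ criticalBeta 3 := criticalBeta_nonneg 3
  have hm0 : 0 ≤ plusBoxMag K n := plusBoxMag_nonneg K n
  refine ⟨hm0, ?_⟩
  -- the finite-volume inequality, for every large `L`
  have key : ∀ L : ℕ, K * n + n + 1 ≤ L →
      plusBoxMag K n ≤ ∑ i : Fin 6, frozenMagShift n L (faceShift n i) (facePatch K n) := by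
    intro L hL
    obtain ⟨hxΛ, hxE, hEΛ, hdisj⟩ := hGEO K n L hL
    have hsub := hSUB (criticalBeta 3) 0 hβ le_rfl (box 3 L) (evalSite n) 6 (face K n) hxΛ hxE hEΛ hdisj
    have hpos : 0 ≤ isingExpect (zdGraph 3) (box 3 L) (criticalBeta 3) 0 BoundaryCondition.plus
        (spinAt (evalSite n)) := by
      have h1 := GKSInequalities.gks_one_holds (zdGraph 3) (Λ := box 3 L) (A := {evalSite n})
        (β := criticalBeta 3) (h := 0) (bc := .plus) hβ le_rfl (Or.inr rfl)
        (Finset.singleton_subset_iff.2 hxΛ)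
      have hs : spinProduct ({evalSite n} : Finset (Site 3)) = spinAt (evalSite n) := by
        funext s; simp [spinProduct]
      rwa [isingCorr, hs] at h1
    rw [hMKV K n L hL]
    calc frozenMag n L (Finset.univ.biUnion (face K n))
        ≤ ∑ i : Fin 6, frozenMag n L (face K n i) := by
          unfold frozenMag
          push_cast at hsub
          linarith [hsub, hpos]
      _ = ∑ i : Fin 6, frozenMagShift n L (faceShift n i) (facePatch K n) :=
          Finset.sum_congr rfl fun i _ => hSYM K n L i
  -- pass to the limit `L → ∞`
  have hlim : Filter.Tendsto (fun L : ℕ => ∑ i : Fin 6, frozenMagShift n L (faceShift n i) (facePatch K n))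
      Filter.atTop (nhds (∑ _i : Fin 6, faceMag K n)) :=
    tendsto_finsetSum _ fun i _ => hLIM K n (faceShift n i)
  have h6 : (∑ _i : Fin 6, faceMag K n) = 6 * faceMag K n := by simp
  rw [← h6]
  exact ge_of_tendsto hlim (Filter.eventually_atTop.2 ⟨K * n + n + 1, fun L hL => key L hL⟩)

/-! ### Composition: the three statements give the crux BY NAME -/

/-- **`OneArmHyperscaling` from the line's three statements** (pure real arithmetic:
`m⁺² ≤ 36 F² ≤ 36 C² T²/S ≤ 36 C² ⟨σ₀σ_{2ne₀}⟩`; the degenerate case `S ≤ 0` is harmless because then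
`T/√S = 0` forces `F ≤ 0`, hence `m⁺ = 0`). -/
theorem OneArmHyperscaling_of :
    MirrorCauchySchwarz → FaceSubadditivity → FaceSaturation →
      Summit.CriticalPhenomena.Ising3DConformalLimit.Theses.ArmHyperscaling.OneArmHyperscaling := by
  intro h1 h2 h3
  obtain ⟨K, hK, C, hC⟩ := h3
  refine ⟨K, by omega, 36 * C ^ 2, fun n hn => ?_⟩
  have hT := h1 K n hK hn
  obtain ⟨hm0, hm⟩ := h2 K n hK hn
  have hF := hC n hn
  have hτ : 0 ≤ criticalTwoPoint 3 (Pi.single 0 (2 * (n : ℤ))) := criticalTwoPoint_nonneg' _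
  show plusBoxMag K n ^ 2 ≤ 36 * C ^ 2 * criticalTwoPoint 3 (Pi.single 0 (2 * (n : ℤ)))
  set τ := criticalTwoPoint 3 (Pi.single 0 (2 * (n : ℤ))) with hτdef
  set m := plusBoxMag K n with hmdef
  set F := faceMag K n with hFdef
  set T := faceResponse K n with hTdef
  set S := mirrorGram K n with hSdef
  have hF0 : 0 ≤ F := by linarith
  have key : F ^ 2 ≤ C ^ 2 * τ := by
    by_cases hS : 0 < S
    · have hTS : T ^ 2 / S ≤ τ := by
        rw [div_le_iff₀ hS]
        linarith
      have h1' : F ≤ C * (T / Real.sqrt S) := by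
        rw [← mul_div_assoc]
        exact hF
      calc F ^ 2 ≤ (C * (T / Real.sqrt S)) ^ 2 := pow_le_pow_left₀ hF0 h1' 2
        _ = C ^ 2 * (T ^ 2 / S) := by
            rw [mul_pow, div_pow, Real.sq_sqrt hS.le]
        _ ≤ C ^ 2 * τ := by
            exact mul_le_mul_of_nonneg_left hTS (sq_nonneg C)
    · have hS' : S ≤ 0 := not_lt.mp hS
      have hsqrt : Real.sqrt S = 0 := Real.sqrt_eq_zero'.mpr hS'
      have hFle : F ≤ 0 := by
        rw [hsqrt, div_zero] at hF
        exact hF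
      have hF00 : F = 0 := le_antisymm hFle hF0
      calc F ^ 2 = 0 := by rw [hF00]; ring
        _ ≤ C ^ 2 * τ := mul_nonneg (sq_nonneg C) hτ
  calc m ^ 2 ≤ (6 * F) ^ 2 := pow_le_pow_left₀ hm0 hm 2
    _ = 36 * F ^ 2 := by ring
    _ ≤ 36 * (C ^ 2 * τ) := by linarith
    _ = 36 * C ^ 2 * τ := by ring

/-- **The crux reduced to its open core**: the face-saturation inequality implies `OneArmHyperscaling`
(sorry-free: mirror Cauchy–Schwarz + the five face stubs + the arithmetic composition). -/
theorem OneArmHyperscaling_of_faceSaturation (hSAT : FaceSaturation) :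
    Summit.CriticalPhenomena.Ising3DConformalLimit.Theses.ArmHyperscaling.OneArmHyperscaling :=
  OneArmHyperscaling_of stub_mirrorCauchySchwarz
    (faceSubadditivity_of stub_plusMagSubmodular stub_boxMagMarkov stub_faceGeometry stub_faceSymmetry
      stub_faceLimit)
    hSAT

/-- **Face subadditivity holds** (`0 ≤ m⁺_{Kn} ≤ 6·faceMag K n` for `K ≥ 2`, `n ≥ 1`): the strategist's stub
`stub_faceSubadditivity`, proved from the five landed face stubs (registered glue sub-goal `faceSubadditivity_proof`). -/
theorem faceSubadditivity_proof : FaceSubadditivity :=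
  faceSubadditivity_of stub_plusMagSubmodular stub_boxMagMarkov stub_faceGeometry stub_faceSymmetry stub_faceLimit

end Summit.CriticalPhenomena.Ising3DConformalLimit.Cruxes.OneArmHyperscaling.MirrorFaceSaturation

end
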